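import Summits.QuantumFields.YangMills.Theorems.BalabanUVNodesN15CurvedLocalSpeciesOfReg335UN
import HarnessLib

/-!
# Route «BalabanUVNodes» (cluster K4 «SpineRates»), Track-A DAG node N15 = NE2, BACKGROUND LAYER — PRINT's PERTURBATION CLASS (3.37) BY NAME FEEDS THE CURVED SPECIES AT A GENUINE
# `U(N)` PAIR: for a unitary background `U` and a Hermitian `A′` in lit-balaban r06's class `Cplx337` («U′ = e^{iηA′} … |A′| < α₁(Lʲη)⁻¹, |∇^η_U A′| < α₁(Lʲη)⁻² on Ω_j», covariant
# derivative `∇^η_U`) BOTH group-level letters of g5 FILE 2 hold — `‖U′(b) − 1‖ ≤ η·(α₁∕ξ)e^{ηα₁∕ξ}` AND the COVARIANT one `‖U′_ν(z + e_κ) − U_κ(z)⁻¹U′_ν(z)U_κ(z)‖ ≤ η²·(α₁∕ξ²)e^{ηα₁∕ξ}`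
# —, so `hV` for n15-w3's curved species `V̂_R(S)` at the pair `(e^{iηA′}, U)` holds with BOTH displayed letters DISCHARGED (the (3.37) companion of `…N15CurvedLocalSpeciesOfReg335UN`)

Cell `pub-ymgap`, seat `pub-ymgap-dag-n15-w2` (WIDTH SEAT 2∕3 on node N15, director-ym №197 ∕ HUMAN RULING D-0149), g6, second piece (bus CLAIM-2 I.39754).  `bears_on: R4∕N15 · K3⁸
SpineGivenEndpointR13SepCoPHV (stmt-QuantumFields-27366)`.  Filed `--kind proof --supports stmt-QuantumFields-27366 --as helper` — COUNT-NEUTRAL.  Theorems only; 0 `def`, 0 `sorry`.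
Imports BY NAME this seat's g6 FILE 1 `…CurvedLocalSpeciesOfReg335UN` (`val_fluct`, `norm_I_eta_smul`, `uN_val_inv_eq_conjTranspose`; through it g5 FILE 2 `…CurvedPerturbationLettersUN`
(`uN_hasMaj_unstackM_curvCoef_group_rate`; n15-w3 file 1 `curvCoefC`∕`curvCoefA`), g5 FILE 3 (`frobenius_norm_le_sqrt_card_mul_l2_opNorm`), lit-balaban r06 `B9Eq335RegularityClasses`
(`Cplx337`, `Cplx337Own`, `OnOmega`, `cplx337_zero`, `norm_le_eta_mul_of_norm_inv_smul_lt`; `B9Eq39Adjoint.covD`∕`R`∕`fluct`), `B9Eq335Plaquette` (`norm_exp_sub_one_le_mul`,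
`norm_exp_sub_exp_le_of_le`), `B12Membership314.exp_units_conj'` and Mathlib's `NormedSpace.exp_mem_unitary_of_mem_skewAdjoint`); nothing in the tree is modified, no landed name
re-declared.

WHY.  FILE 1 made print's BACKGROUND class (3.35) the entrance of the flat-base-point route (background in its own cube gauge, g5 FILE 11).  The CURVED route of the lineage — n15-w3
file 1's species `V̂_R(S) = unstackM (curvCoefC η τ R S) (curvCoefA η τ R S)` of a perturbation `S` around a LIVE background `R`, (3.52)–(3.53) in transporter form — has its `U(N)`
entrance in g5 FILE 2 `uN_hasMaj_unstackM_curvCoef_group_rate`: `hV` at a GENUINE pair (`R = coordMat e (Ad_U)`, `S = coordMat e (Ad_{U′})`) from TWO group-level letters, both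
DISPLAYED there: `‖U′_μ(x) − 1‖_F ≤ ηa` and the COVARIANT backward difference `‖U′_μ(x) − U₋ᴴU′_μ(x − e_μ)U₋‖_F ≤ η²b` (`U₋ = U_μ(x − e_μ)`).  In print these are the perturbation
class: [Balaban1985BackgroundPropagators] (3.37) p. 396 *«We assume that they have the form U′U, where U has values in G and U′ = e^{iηA′}, A′ ∈ 𝔤ᶜ. For a given pair of positive numbers
α₀, α₁ we consider the class of these configurations satisfying: U satisfies the condition (3.35), and |A′| < α₁(Lʲη)⁻¹, |∇^η_U A′| < α₁(Lʲη)⁻² on Ω_j, j = 0, …, k»* — the domain of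
Thm 3.4 p. 400 («as analytic functions of A′»).  The tree HAS it as a predicate with body: r06's `B9Eq335RegularityClasses.Cplx337 T U η L lev α₁ A′` (nested, every `Ω_j ∋ x`) and
`Cplx337Own` (own level), with the COVARIANT derivative `∇^η_U = η⁻¹D¹_U`, `(D¹_{U,μ}f)(x) = U_μ(x)f(x + e_μ)U_μ(x)⁻¹ − f(x)` ((3.3), `B9Eq39Adjoint.covD`) — consumed by 57 [B9]
Literature files and by NO N15 file (the N15 carriers set the field `Cplx337 := fun _ _ _ => True`).  THIS FILE makes the class the entrance of the curved route:
* §1 (ANY complete normed ℂ-algebra with `‖1‖ = 1`) `norm_inv_conj_le` (`‖V⁻¹XV‖ ≤ ‖X‖` for `V` of unitary type), `sub_inv_conj_eq_inv_conj_covD`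
  (`f(z + e_κ) − U⁻¹f(z)U = U⁻¹(D¹_{U,κ}f)(z)U`), ★★ `pertLetters_of_cplx337_shape` — the two (3.37) letters AT ONE SCALE `ξ` as binders (`‖A′_ν‖ < αξ⁻¹` at `z` and `z + e_κ`,
  `‖η⁻¹D¹_{U,κ}A′_ν(z)‖ < αξ⁻²`, `U_κ(z)` of unitary type) ⟹ FIRST LETTER `‖U′_ν(z) − 1‖ ≤ η·(α∕ξ)e^{ηα∕ξ}` and COVARIANT SECOND LETTER
  `‖U′_ν(z + e_κ) − U_κ(z)⁻¹U′_ν(z)U_κ(z)‖ ≤ η²·(α∕ξ²)e^{ηα∕ξ}` («R(u) exp iηA = exp iηR(u)A» p. 395 = `B12Membership314.exp_units_conj'`; both exponents in the ball of radius `ηα∕ξ`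
  by the contraction `‖U⁻¹XU‖ ≤ ‖X‖`; `exp` `e^{ηα∕ξ}`-Lipschitz there); ★★ `pertLetters_of_cplx337` (BY NAME from `Cplx337` on `Ω_j`, `ξ = Lʲη`), ★ `pertLetters_of_cplx337Own`.
* §2 (`𝔸 = M_n(ℂ)`, operator norm) `uN_fluct_mem_unitaryGroup_of_isHermitian` (print's «A′ ∈ 𝔤»: Hermitian `A′` ⟹ `e^{iηA′} ∈ U(n)`), ★★ `uN_pertLetters_of_cplx337_shape` (unitary
  background, Hermitian `A′`: `U′` unitary + both op-norm letters, `U⁻¹ = Uᴴ`).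
* §3 ★★★ `uN_hasMaj_curvSpecies_rate_of_cplx337_shape` ∕ ★★★ **`uN_hasMaj_curvSpecies_rate_of_cplx337`** — THE JUNCTION: unitary background `U`, Hermitian `A′` with the (3.37)
  letters relative to `U` at one scale `ξ` (resp. in `Cplx337` BY NAME on a carrier inside one `Ω_j`, `ξ = Lʲη`) ⟹ g5 FILE 2's `hV` for `V̂` at the pair `(e^{iηA′}, U)` for EVERY `δ_V`
  with `a := √|n|·(α∕ξ)e^{ηα∕ξ}`, `b := √|n|·(α∕ξ²)e^{ηα∕ξ}` (`‖·‖_F ≤ √|n|‖·‖_{op}`, g5 FILE 3; FILE 2 verbatim, its covariant letter = §2's along the own direction at `z = x − e_μ`).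
* §4 (A6) `uN_cplx337_zero` — `A′ = 0` is Hermitian and in the class over every background for every `α₁ > 0` (r06 `cplx337_zero` BY NAME): the hypothesis set is inhabited.

HONEST FRAMING ∕ LIMITS.  Exponential-map bookkeeping over a Literature PREDICATE WITH BODY ((3.37) p. 396 as typed by r06; the level function `lev`, `L`, `α₁` are parameters) +
finite-dimensional linear algebra (`√|n|` crude).  REAL POINTS ONLY: `A′` Hermitian (print's «U′ with values in G»); the COMPLEX domain `A′ ∈ 𝔤ᶜ` of Thm 3.4's analyticity is NOT
served by the lineage's real-orthogonal transporter currency and is not claimed.  The class (3.37) (and the background's (3.35)) are HYPOTHESES exactly as in [B9] Thm 3.4; nothing of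
[B5]∕[B6]∕[B9] asserted beyond cited shapes; NE2⁺ NOT PRINTED ∕ NOT proved; N15 NOT discharged; K3⁸ OPEN, skeleton v6 untouched (0∕2); counts of record UNMOVED (typed 28∕28 ·
discharged 5∕27 · A 5∕28); one finite 𝕋⁴ at fixed ε — NOT ℝ⁴ ∕ OS ∕ mass gap ∕ Clay; R4 closes the conditional finite-𝕋⁴ rung `BalabanLadder.UV` only.  Restate-immune (no Theses import).
-/

set_option autoImplicit false

noncomputable section
open scoped BigOperators Matrix

namespace Summit.QuantumFields.YangMills.BalabanUVNodes.N15.CurvedSpecies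

/-! ## §1 The class (3.37) at one scale ⟹ BOTH perturbation letters, the second one COVARIANT (any complete normed ℂ-algebra with `‖1‖ = 1`) -/

section Generic

open NormedSpace
open Literature.MathematicalPhysics.QuantumFieldTheory.Balaban1983to89
open Literature.MathematicalPhysics.QuantumFieldTheory.Balaban1983to89.B9Eq39Adjoint (R covD fluct)
open Literature.MathematicalPhysics.QuantumFieldTheory.Balaban1983to89.B9Eq335RegularityClasses (Cplx337 Cplx337Own OnOmega norm_le_eta_mul_of_norm_inv_smul_lt)
open Literature.MathematicalPhysics.QuantumFieldTheory.Balaban1983to89.B9Eq335Plaquette (norm_exp_sub_one_le_mul norm_exp_sub_exp_le_of_le)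
open Literature.MathematicalPhysics.QuantumFieldTheory.Balaban1983to89.LatticeNorms (scaleLen)

variable {𝔸 : Type*} [NormedRing 𝔸] [NormedAlgebra ℂ 𝔸] [CompleteSpace 𝔸] [NormOneClass 𝔸] {S ι : Type*}
  (T : ι → Equiv.Perm S) (U : ι → S → 𝔸ˣ)

omit [NormedAlgebra ℂ 𝔸] [CompleteSpace 𝔸] [NormOneClass 𝔸] in
/-- Conjugation by a unit of unitary type does not increase the norm: `‖V⁻¹XV‖ ≤ ‖X‖` for `‖V‖, ‖V⁻¹‖ ≤ 1`. [folklore] -/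
theorem norm_inv_conj_le {V : 𝔸ˣ} (hV : ‖(V : 𝔸)‖ ≤ 1 ∧ ‖(((V⁻¹ : 𝔸ˣ)) : 𝔸)‖ ≤ 1) (X : 𝔸) :
    ‖(((V⁻¹ : 𝔸ˣ)) : 𝔸) * X * (V : 𝔸)‖ ≤ ‖X‖ := by
  calc ‖(((V⁻¹ : 𝔸ˣ)) : 𝔸) * X * (V : 𝔸)‖ ≤ ‖(((V⁻¹ : 𝔸ˣ)) : 𝔸)‖ * ‖X‖ * ‖(V : 𝔸)‖ :=
        (norm_mul_le _ _).trans (mul_le_mul_of_nonneg_right (norm_mul_le _ _) (norm_nonneg _))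
    _ ≤ 1 * ‖X‖ * 1 := by gcongr <;> [exact hV.2; exact hV.1]
    _ = ‖X‖ := by ring

omit [NormedAlgebra ℂ 𝔸] [CompleteSpace 𝔸] [NormOneClass 𝔸] in
/-- The covariant difference read from the other end: `f(z + e_κ) − U_κ(z)⁻¹f(z)U_κ(z) = U_κ(z)⁻¹·(D¹_{U,κ}f)(z)·U_κ(z)`. [cite: Balaban1985BackgroundPropagators, (3.3) p.391] -/
theorem sub_inv_conj_eq_inv_conj_covD (κ : ι) (f : S → 𝔸) (z : S) :
    f (T κ z) - (((U κ z)⁻¹ : 𝔸ˣ) : 𝔸) * f z * (U κ z : 𝔸) = (((U κ z)⁻¹ : 𝔸ˣ) : 𝔸) * covD T U κ f z * (U κ z : 𝔸) := by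
  rw [covD, B9Eq39Adjoint.R_def, mul_sub, sub_mul]
  congr 1
  simp only [← mul_assoc, Units.inv_mul, one_mul]
  rw [mul_assoc, Units.inv_mul, mul_one]

/-- ★★ **BOTH PERTURBATION LETTERS FROM THE (3.37) LETTERS AT ONE SCALE, the second one COVARIANT** (binders; `U′ := e^{iηA′}` = r06's `fluct η A′`): a background `U` of unitary
type on the sites considered (`‖U_κ(z)‖, ‖U_κ(z)⁻¹‖ ≤ 1`), `‖A′_κ(z)‖ < α·ξ⁻¹`, `‖η⁻¹(D¹_{U,κ}A′_ν)(z)‖ < α·(ξ²)⁻¹` (print's `|∇^η_U A′| < α₁(Lʲη)⁻²`), `η > 0` ⟹ FIRST LETTER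
`‖U′_κ(z) − 1‖ ≤ η·(α∕ξ)·e^{ηα∕ξ}` and COVARIANT SECOND LETTER `‖U′_ν(z + e_κ) − U_κ(z)⁻¹U′_ν(z)U_κ(z)‖ ≤ η²·(α∕ξ²)·e^{ηα∕ξ}` for ALL `κ, ν`: «R(u) exp iηA = exp iηR(u)A» (p. 395;
the tree's `B12Membership314.exp_units_conj'`) turns `U⁻¹U′(z)U` into `exp(iη·U⁻¹A′(z)U)`, `A′(z + e_κ) − U⁻¹A′(z)U = U⁻¹(D¹_{U,κ}A′)(z)U` has norm `≤ η·αξ⁻²`, both exponents have norm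
`≤ ηα∕ξ`, and `exp` is `e^{ηα∕ξ}`-Lipschitz on that ball. [cite: Balaban1985BackgroundPropagators, (3.37) p.396, (3.3) p.391, p.395 («R(u(x)) exp iηA = exp iηR(u(x))A»)] -/
theorem pertLetters_of_cplx337_shape {η : ℝ} (hη : 0 < η) {ξ α : ℝ} {A' : ι → S → 𝔸} {κ ν : ι} {z : S}
    (hU : ‖(U κ z : 𝔸)‖ ≤ 1 ∧ ‖((((U κ z)⁻¹ : 𝔸ˣ)) : 𝔸)‖ ≤ 1) (hAz : ‖A' ν z‖ < α * ξ⁻¹) (hATz : ‖A' ν (T κ z)‖ < α * ξ⁻¹)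
    (hD : ‖((η : ℂ)⁻¹) • covD T U κ (A' ν) z‖ < α * (ξ ^ 2)⁻¹) :
    ‖(fluct η A' ν z : 𝔸) - 1‖ ≤ η * (α / ξ) * Real.exp (η * (α / ξ)) ∧
      ‖(fluct η A' ν (T κ z) : 𝔸) - (((U κ z)⁻¹ : 𝔸ˣ) : 𝔸) * fluct η A' ν z * (U κ z : 𝔸)‖ ≤ η ^ 2 * (α / ξ ^ 2) * Real.exp (η * (α / ξ)) := by
  have hX : ∀ {a : 𝔸}, ‖a‖ < α * ξ⁻¹ → ‖(Complex.I * η : ℂ) • a‖ ≤ η * (α / ξ) := fun ha => by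
    rw [norm_I_eta_smul hη.le, div_eq_mul_inv]
    exact mul_le_mul_of_nonneg_left ha.le hη.le
  refine ⟨?_, ?_⟩
  · rw [val_fluct]
    exact (norm_exp_sub_one_le_mul _).trans
      (mul_le_mul (hX hAz) (Real.exp_le_exp.mpr (hX hAz)) (Real.exp_pos _).le ((norm_nonneg _).trans (hX hAz)))
  · -- conjugate the exponential: `U⁻¹ e^{iηA′(z)} U = e^{iη U⁻¹A′(z)U}`
    have hconj : (((U κ z)⁻¹ : 𝔸ˣ) : 𝔸) * (fluct η A' ν z : 𝔸) * (U κ z : 𝔸) =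
        exp ((Complex.I * η : ℂ) • ((((U κ z)⁻¹ : 𝔸ˣ) : 𝔸) * A' ν z * (U κ z : 𝔸))) := by
      rw [val_fluct, ← smul_mul_assoc, ← mul_smul_comm]
      have h := B12Membership314.exp_units_conj' (U κ z)⁻¹ ((Complex.I * η : ℂ) • A' ν z)
      rw [inv_inv] at h
      exact h.symm
    have hY : ‖(Complex.I * η : ℂ) • ((((U κ z)⁻¹ : 𝔸ˣ) : 𝔸) * A' ν z * (U κ z : 𝔸))‖ ≤ η * (α / ξ) := by
      rw [norm_I_eta_smul hη.le, div_eq_mul_inv]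
      exact mul_le_mul_of_nonneg_left ((norm_inv_conj_le hU _).trans hAz.le) hη.le
    rw [hconj, val_fluct]
    refine (norm_exp_sub_exp_le_of_le _ _ (hX hATz) hY).trans ?_
    have hdiff : (Complex.I * η : ℂ) • A' ν (T κ z) - (Complex.I * η : ℂ) • ((((U κ z)⁻¹ : 𝔸ˣ) : 𝔸) * A' ν z * (U κ z : 𝔸)) =
        (Complex.I * η : ℂ) • ((((U κ z)⁻¹ : 𝔸ˣ) : 𝔸) * covD T U κ (A' ν) z * (U κ z : 𝔸)) := by
      rw [← smul_sub, sub_inv_conj_eq_inv_conj_covD]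
    have hcov : ‖covD T U κ (A' ν) z‖ ≤ η * (α * (ξ ^ 2)⁻¹) := norm_le_eta_mul_of_norm_inv_smul_lt hη hD
    rw [hdiff, norm_I_eta_smul hη.le]
    calc η * ‖(((U κ z)⁻¹ : 𝔸ˣ) : 𝔸) * covD T U κ (A' ν) z * (U κ z : 𝔸)‖ * Real.exp (η * (α / ξ))
        ≤ η * (η * (α * (ξ ^ 2)⁻¹)) * Real.exp (η * (α / ξ)) := by
          gcongr
          exact (norm_inv_conj_le hU _).trans hcov
      _ = η ^ 2 * (α / ξ ^ 2) * Real.exp (η * (α / ξ)) := by rw [div_eq_mul_inv]; ring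

/-- ★★ **THE CLASS (3.37) BY NAME, NESTED READING, ⟹ BOTH LETTERS ON `Ω_j` AT THE SCALE `ξ = Lʲη`**: `Cplx337 T U η L lev α₁ A′` (r06: «|A′| < α₁(Lʲη)⁻¹, |∇^η_U A′| < α₁(Lʲη)⁻² on
Ω_j»), `U` of unitary type, `η > 0` ⟹ for `z, z + e_κ ∈ Ω_j`: `‖U′_ν(z) − 1‖ ≤ η·(α₁∕Lʲη)e^{ηα₁∕Lʲη}` and `‖U′_ν(z + e_κ) − U_κ(z)⁻¹U′_ν(z)U_κ(z)‖ ≤ η²·(α₁∕(Lʲη)²)e^{ηα₁∕Lʲη}`.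
[cite: Balaban1985BackgroundPropagators, (3.37) p.396] -/
theorem pertLetters_of_cplx337 {η L : ℝ} (hη : 0 < η) {lev : S → ℕ} {α₁ : ℝ} {A' : ι → S → 𝔸} (h : Cplx337 T U η L lev α₁ A')
    (hU1 : ∀ κ z, ‖(U κ z : 𝔸)‖ ≤ 1 ∧ ‖((((U κ z)⁻¹ : 𝔸ˣ)) : 𝔸)‖ ≤ 1) {j : ℕ} {κ ν : ι} {z : S} (hz : OnOmega lev j z) (hTz : OnOmega lev j (T κ z)) :
    ‖(fluct η A' ν z : 𝔸) - 1‖ ≤ η * (α₁ / scaleLen L η j) * Real.exp (η * (α₁ / scaleLen L η j)) ∧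
      ‖(fluct η A' ν (T κ z) : 𝔸) - (((U κ z)⁻¹ : 𝔸ˣ) : 𝔸) * fluct η A' ν z * (U κ z : 𝔸)‖ ≤
        η ^ 2 * (α₁ / scaleLen L η j ^ 2) * Real.exp (η * (α₁ / scaleLen L η j)) :=
  pertLetters_of_cplx337_shape T U hη (hU1 κ z) (h.1 j ν z hz) (h.1 j ν (T κ z) hTz) (h.2 j κ ν z hz)

/-- ★ **THE SAME FROM THE OWN-LEVEL READING** `Cplx337Own` (r06's blockwise reading «Ω_j∖Ω_{j+1}», equivalent to the nested one by the p. 397 remark `cplx337_iff_own`) at two sites of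
the SAME level `lev z = lev (z + e_κ) = j`. [cite: Balaban1985BackgroundPropagators, (3.37) p.396, p.397 (sentence after (3.41))] -/
theorem pertLetters_of_cplx337Own {η L : ℝ} (hη : 0 < η) {lev : S → ℕ} {α₁ : ℝ} {A' : ι → S → 𝔸} (h : Cplx337Own T U η L lev α₁ A')
    (hU1 : ∀ κ z, ‖(U κ z : 𝔸)‖ ≤ 1 ∧ ‖((((U κ z)⁻¹ : 𝔸ˣ)) : 𝔸)‖ ≤ 1) {j : ℕ} {κ ν : ι} {z : S} (hz : lev z = j) (hTz : lev (T κ z) = j) :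
    ‖(fluct η A' ν z : 𝔸) - 1‖ ≤ η * (α₁ / scaleLen L η j) * Real.exp (η * (α₁ / scaleLen L η j)) ∧
      ‖(fluct η A' ν (T κ z) : 𝔸) - (((U κ z)⁻¹ : 𝔸ˣ) : 𝔸) * fluct η A' ν z * (U κ z : 𝔸)‖ ≤
        η ^ 2 * (α₁ / scaleLen L η j ^ 2) * Real.exp (η * (α₁ / scaleLen L η j)) := by
  have h1 := h.1 ν z; have h2 := h.1 ν (T κ z); have h3 := h.2 κ ν z
  rw [hz] at h1 h3; rw [hTz] at h2
  exact pertLetters_of_cplx337_shape T U hη (hU1 κ z) h1 h2 h3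

end Generic

/-! ## §2 `𝔸 = M_n(ℂ)` (operator norm): Hermitian `A′` exponentiates into `U(n)`; the letters for a unitary background -/

section MatrixOp

open scoped Matrix.Norms.L2Operator
open NormedSpace
open Literature.MathematicalPhysics.QuantumFieldTheory.Balaban1983to89
open Literature.MathematicalPhysics.QuantumFieldTheory.Balaban1983to89.B9Eq39Adjoint (covD fluct)

variable {n : Type} [Fintype n] [DecidableEq n] {X J : Type} (τ : J → Equiv.Perm X) (V : J → X → (Matrix n n ℂ)ˣ)

/-- **print's «A′ ∈ 𝔤»**: for a HERMITIAN `A′(b)` the fluctuation bond variable `U′(b) = e^{iηA′(b)}` is UNITARY (`iηA′` is skew-adjoint; Mathlib's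
`NormedSpace.exp_mem_unitary_of_mem_skewAdjoint` in the C⋆-algebra `M_n(ℂ)`). [cite: Balaban1985BackgroundPropagators, p.390 («U′ = exp iηA», «A′ ∈ 𝔤»), p.396] -/
theorem uN_fluct_mem_unitaryGroup_of_isHermitian (η : ℝ) {A' : J → X → Matrix n n ℂ} (hA : ∀ μ x, (A' μ x)ᴴ = A' μ x) (μ : J) (x : X) :
    (fluct η A' μ x : Matrix n n ℂ) ∈ Matrix.unitaryGroup n ℂ := by
  letI : NormedAlgebra ℚ (Matrix n n ℂ) := NormedAlgebra.restrictScalars ℚ ℂ (Matrix n n ℂ)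
  rw [val_fluct]
  refine exp_mem_unitary_of_mem_skewAdjoint (skewAdjoint.mem_iff.mpr ?_)
  rw [Matrix.star_eq_conjTranspose, Matrix.conjTranspose_smul, hA μ x, ← neg_smul]
  congr 1
  rw [Complex.star_def, map_mul, Complex.conj_I, Complex.conj_ofReal, neg_mul]

/-- ★★ **`𝔸 = M_n(ℂ)`: UNITARY BACKGROUND, HERMITIAN `A′` WITH THE (3.37) LETTERS AT ONE SCALE ⟹ `U′ = e^{iηA′}` IS UNITARY AND BOTH LETTERS HOLD (operator norm)**:
`‖U′_ν(z) − 1‖_{op} ≤ η·(α∕ξ)e^{ηα∕ξ}` and `‖U′_ν(z + e_κ) − V_κ(z)ᴴU′_ν(z)V_κ(z)‖_{op} ≤ η²·(α∕ξ²)e^{ηα∕ξ}` (covariant, ALL `κ, ν`; unitary ⟹ unitary type by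
`CStarRing.norm_of_mem_unitary`, `V⁻¹ = Vᴴ`). [cite: Balaban1985BackgroundPropagators, (3.37) p.396, p.395] -/
theorem uN_pertLetters_of_cplx337_shape [Nonempty n] {η : ℝ} (hη : 0 < η) (hV : ∀ μ x, (V μ x : Matrix n n ℂ) ∈ Matrix.unitaryGroup n ℂ) {ξ α : ℝ}
    {A' : J → X → Matrix n n ℂ} (hA : ∀ μ x, (A' μ x)ᴴ = A' μ x) (hAα : ∀ μ x, ‖A' μ x‖ < α * ξ⁻¹)
    (hD : ∀ μ ν x, ‖((η : ℂ)⁻¹) • covD τ V μ (A' ν) x‖ < α * (ξ ^ 2)⁻¹) (κ ν : J) (z : X) :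
    (fluct η A' ν z : Matrix n n ℂ) ∈ Matrix.unitaryGroup n ℂ ∧
      ‖(fluct η A' ν z : Matrix n n ℂ) - 1‖ ≤ η * (α / ξ) * Real.exp (η * (α / ξ)) ∧
      ‖(fluct η A' ν (τ κ z) : Matrix n n ℂ) - (V κ z : Matrix n n ℂ)ᴴ * (fluct η A' ν z : Matrix n n ℂ) * (V κ z : Matrix n n ℂ)‖ ≤
        η ^ 2 * (α / ξ ^ 2) * Real.exp (η * (α / ξ)) := by
  have hV1 : ‖(V κ z : Matrix n n ℂ)‖ ≤ 1 ∧ ‖((((V κ z)⁻¹ : (Matrix n n ℂ)ˣ)) : Matrix n n ℂ)‖ ≤ 1 :=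
    ⟨(CStarRing.norm_of_mem_unitary (hV κ z)).le, by
      rw [uN_val_inv_eq_conjTranspose (hV κ z)]
      exact (CStarRing.norm_of_mem_unitary (Unitary.star_mem (hV κ z))).le⟩
  obtain ⟨h1, h2⟩ := pertLetters_of_cplx337_shape τ V hη hV1 (hAα ν z) (hAα ν (τ κ z)) (hD κ ν z)
  rw [uN_val_inv_eq_conjTranspose (hV κ z)] at h2
  exact ⟨uN_fluct_mem_unitaryGroup_of_isHermitian η hA ν z, h1, h2⟩

end MatrixOp

/-! ## §3 THE JUNCTION: (3.37) ⟹ g5 FILE 2's `hV` for the CURVED species at the genuine pair `(e^{iηA′}, U)`, both letters discharged -/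

section Junction

open scoped Matrix.Norms.L2Operator
open Literature.MathematicalPhysics.QuantumFieldTheory.Balaban1983to89
open Literature.MathematicalPhysics.QuantumFieldTheory.Balaban1983to89.B11SectG (BlockNorm HasMaj)
open Literature.MathematicalPhysics.QuantumFieldTheory.Balaban1983to89.B9Eq39Adjoint (covD fluct)
open Literature.MathematicalPhysics.QuantumFieldTheory.Balaban1983to89.B9Eq335RegularityClasses (Cplx337 OnOmega cplx337_zero)
open Literature.MathematicalPhysics.QuantumFieldTheory.Balaban1983to89.LatticeNorms (scaleLen)
open Summit.QuantumFields.YangMills.BalabanUVNodes.N15.MatrixSpecies (liftBlk coordMat basisConst basisConst_nonneg)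
open Summit.QuantumFields.YangMills.BalabanUVNodes.N15.BackgroundLayer (unstackM blkPair)
open Literature.Barriers.QuantumFields (traceForm)

variable {n : Type} [Fintype n] [DecidableEq n] [Nonempty n] {κ : Type} [Fintype κ] [DecidableEq κ] (e : Matrix n n ℂ ≃L[ℝ] (κ → ℝ))
variable {X J : Type} [Fintype X] [Fintype J] (τ : J → X ≃ X) (V : J → X → (Matrix n n ℂ)ˣ)

/-- ★★★ **THE JUNCTION AT ONE SCALE — PRINT's PERTURBATION CLASS (3.37) FEEDS THE CURVED SPECIES' `hV` AT A GENUINE `U(N)` PAIR, BOTH LETTERS DISCHARGED.**  A unitary background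
`V` (bond variables on the cube device's carrier `X`, shifts `τ`), a HERMITIAN perturbation potential `A′` («A′ ∈ 𝔤») with the two (3.37) letters at the scale `ξ` RELATIVE TO `V` —
`‖A′_μ(x)‖_{op} < α·ξ⁻¹`, `‖η⁻¹(D¹_{V,μ}A′_ν)(x)‖_{op} < α·(ξ²)⁻¹` —, `η > 0`, `ξ > 0`, `α ≥ 0`, `d(y, y) = 0` ⟹ n15-w3's CURVED species
`V̂ = unstackM (curvCoefC η τ R S) (curvCoefA η τ R S)` of the pair (background transporters `R_μ(x) = coordMat e (Ad_{V_μ(x)})`, perturbation transporters `S_μ(x) = coordMat e (Ad_{U′_μ(x)})`,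
`U′ = e^{iηA′}`) obeys g5 FILE 2's `hV` letter `curvRowLetter κ J (κ_e·2√|n|·a) (κ_e·2√|n|·b)·(1 + |J ⊕ J|)·e^{−δ_V d}` for EVERY `δ_V`, with `a := √|n|·(α∕ξ)e^{ηα∕ξ}`,
`b := √|n|·(α∕ξ²)e^{ηα∕ξ}` (`κ_e` = the lineage's Frobenius-currency `basisConst e`, written with its instances) — §2's letters (the covariant one along the own direction at
`z = x − e_μ`, `V⁻¹ = Vᴴ`), `‖·‖_F ≤ √|n|·‖·‖_{op}` (g5 FILE 3), then g5 FILE 2 `uN_hasMaj_unstackM_curvCoef_group_rate` verbatim.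
[cite: Balaban1985BackgroundPropagators, (3.37) p.396, Thm 3.4 p.400 (the domain (3.37)), (3.52)–(3.53) p.400, (3.63) p.402] -/
theorem uN_hasMaj_curvSpecies_rate_of_cplx337_shape (he : ∀ A B : Matrix n n ℂ, traceForm A B = e A ⬝ᵥ e B) {g : B6.Geometry} (blk : X → g.Site)
    (hd0 : ∀ y : g.Site, g.dist y y = 0) {η : ℝ} (hη : 0 < η) (hV : ∀ μ x, (V μ x : Matrix n n ℂ) ∈ Matrix.unitaryGroup n ℂ) {ξ α : ℝ} (hξ : 0 < ξ) (hα : 0 ≤ α)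
    {A' : J → X → Matrix n n ℂ} (hA : ∀ μ x, (A' μ x)ᴴ = A' μ x) (hAα : ∀ μ x, ‖A' μ x‖ < α * ξ⁻¹)
    (hD : ∀ μ ν x, ‖((η : ℂ)⁻¹) • covD τ V μ (A' ν) x‖ < α * (ξ ^ 2)⁻¹) (δV : ℝ) :
    HasMaj (BlockNorm.ofBlocks g (blkPair (liftBlk blk κ))) (BlockNorm.ofBlocks g (liftBlk blk κ))
      (unstackM (curvCoefC η τ (fun μ x => coordMat e (ContinuousLinearMap.mulLeftRight ℝ (Matrix n n ℂ) (V μ x : Matrix n n ℂ) (V μ x : Matrix n n ℂ)ᴴ))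
          (fun μ x => coordMat e (ContinuousLinearMap.mulLeftRight ℝ (Matrix n n ℂ) (fluct η A' μ x : Matrix n n ℂ) (fluct η A' μ x : Matrix n n ℂ)ᴴ)))
        (curvCoefA η τ (fun μ x => coordMat e (ContinuousLinearMap.mulLeftRight ℝ (Matrix n n ℂ) (V μ x : Matrix n n ℂ) (V μ x : Matrix n n ℂ)ᴴ))
          (fun μ x => coordMat e (ContinuousLinearMap.mulLeftRight ℝ (Matrix n n ℂ) (fluct η A' μ x : Matrix n n ℂ) (fluct η A' μ x : Matrix n n ℂ)ᴴ))))
      (fun y y' => curvRowLetter κ J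
          (@basisConst κ _ (Matrix n n ℂ) Matrix.frobeniusNormedAddCommGroup Matrix.frobeniusNormedSpace e * (2 * Real.sqrt (Fintype.card n)) *
            (Real.sqrt (Fintype.card n) * ((α / ξ) * Real.exp (η * (α / ξ)))))
          (@basisConst κ _ (Matrix n n ℂ) Matrix.frobeniusNormedAddCommGroup Matrix.frobeniusNormedSpace e * (2 * Real.sqrt (Fintype.card n)) *
            (Real.sqrt (Fintype.card n) * ((α / ξ ^ 2) * Real.exp (η * (α / ξ))))) * (1 + Fintype.card (J ⊕ J)) *
        Real.exp (-(δV * g.dist y y'))) := by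
  have hU' : ∀ μ x, (fluct η A' μ x : Matrix n n ℂ)ᴴ * (fluct η A' μ x : Matrix n n ℂ) = 1 := fun μ x =>
    Matrix.mem_unitaryGroup_iff'.mp (uN_fluct_mem_unitaryGroup_of_isHermitian η hA μ x)
  have hV' : ∀ μ x, (V μ x : Matrix n n ℂ)ᴴ * (V μ x : Matrix n n ℂ) = 1 := fun μ x => Matrix.mem_unitaryGroup_iff'.mp (hV μ x)
  have hsq : 0 ≤ Real.sqrt (Fintype.card n) := Real.sqrt_nonneg _
  have ha0 : 0 ≤ Real.sqrt (Fintype.card n) * ((α / ξ) * Real.exp (η * (α / ξ))) := by positivity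
  have hb0 : 0 ≤ Real.sqrt (Fintype.card n) * ((α / ξ ^ 2) * Real.exp (η * (α / ξ))) := by positivity
  refine uN_hasMaj_unstackM_curvCoef_group_rate e blk η τ (fun μ x => (fluct η A' μ x : Matrix n n ℂ)) (fun μ x => (V μ x : Matrix n n ℂ)) he hU' hV' hd0 hη ha0 hb0
    (fun μ x => ?_) (fun μ x => ?_) δV
  · have hop := (uN_pertLetters_of_cplx337_shape τ V hη hV hA hAα hD μ μ x).2.1
    refine (frobenius_norm_le_sqrt_card_mul_l2_opNorm _).trans ?_
    calc Real.sqrt (Fintype.card n) * ‖(fluct η A' μ x : Matrix n n ℂ) - 1‖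
        ≤ Real.sqrt (Fintype.card n) * (η * (α / ξ) * Real.exp (η * (α / ξ))) := mul_le_mul_of_nonneg_left hop hsq
      _ = η * (Real.sqrt (Fintype.card n) * ((α / ξ) * Real.exp (η * (α / ξ)))) := by ring
  · have hop := (uN_pertLetters_of_cplx337_shape τ V hη hV hA hAα hD μ μ ((τ μ).symm x)).2.2
    rw [Equiv.apply_symm_apply] at hop
    refine (frobenius_norm_le_sqrt_card_mul_l2_opNorm _).trans ?_
    calc Real.sqrt (Fintype.card n) *
          ‖(fluct η A' μ x : Matrix n n ℂ) - (V μ ((τ μ).symm x) : Matrix n n ℂ)ᴴ * (fluct η A' μ ((τ μ).symm x) : Matrix n n ℂ) * (V μ ((τ μ).symm x) : Matrix n n ℂ)‖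
        ≤ Real.sqrt (Fintype.card n) * (η ^ 2 * (α / ξ ^ 2) * Real.exp (η * (α / ξ))) := mul_le_mul_of_nonneg_left hop hsq
      _ = η ^ 2 * (Real.sqrt (Fintype.card n) * ((α / ξ ^ 2) * Real.exp (η * (α / ξ)))) := by ring

/-- ★★★ **THE JUNCTION, PRINT's CLASS (3.37) BY NAME**: a unitary background `V`, a Hermitian `A′` in r06's class `Cplx337 τ V η L lev α₁ A′` («|A′| < α₁(Lʲη)⁻¹, |∇^η_U A′| < α₁(Lʲη)⁻² on
Ω_j»), on a carrier all of whose sites lie in `Ω_j` (`OnOmega lev j x` for every `x` — the cube device's carrier sits inside ONE domain `Ω_j`), `η > 0`, `L ≥ 1`, `α₁ ≥ 0`, `d(y, y) = 0` ⟹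
g5 FILE 2's `hV` for the curved species of the pair `(e^{iηA′}, V)` with `a := √|n|·(α₁∕Lʲη)e^{ηα₁∕Lʲη}`, `b := √|n|·(α₁∕(Lʲη)²)e^{ηα₁∕Lʲη}` — BOTH displayed letters of FILE 2 DISCHARGED from
(3.37) by name; the class itself remains the hypothesis, exactly as in [B9] Thm 3.4. [cite: Balaban1985BackgroundPropagators, (3.37) p.396, (3.41) p.397, Thm 3.4 p.400] -/
theorem uN_hasMaj_curvSpecies_rate_of_cplx337 (he : ∀ A B : Matrix n n ℂ, traceForm A B = e A ⬝ᵥ e B) {g : B6.Geometry} (blk : X → g.Site)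
    (hd0 : ∀ y : g.Site, g.dist y y = 0) {η L : ℝ} (hη : 0 < η) (hL : 1 ≤ L) (hV : ∀ μ x, (V μ x : Matrix n n ℂ) ∈ Matrix.unitaryGroup n ℂ) {lev : X → ℕ} {α₁ : ℝ}
    (hα₁ : 0 ≤ α₁) {A' : J → X → Matrix n n ℂ} (hA : ∀ μ x, (A' μ x)ᴴ = A' μ x) (h : Cplx337 τ V η L lev α₁ A') {j : ℕ} (hΩ : ∀ x, OnOmega lev j x) (δV : ℝ) :
    HasMaj (BlockNorm.ofBlocks g (blkPair (liftBlk blk κ))) (BlockNorm.ofBlocks g (liftBlk blk κ))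
      (unstackM (curvCoefC η τ (fun μ x => coordMat e (ContinuousLinearMap.mulLeftRight ℝ (Matrix n n ℂ) (V μ x : Matrix n n ℂ) (V μ x : Matrix n n ℂ)ᴴ))
          (fun μ x => coordMat e (ContinuousLinearMap.mulLeftRight ℝ (Matrix n n ℂ) (fluct η A' μ x : Matrix n n ℂ) (fluct η A' μ x : Matrix n n ℂ)ᴴ)))
        (curvCoefA η τ (fun μ x => coordMat e (ContinuousLinearMap.mulLeftRight ℝ (Matrix n n ℂ) (V μ x : Matrix n n ℂ) (V μ x : Matrix n n ℂ)ᴴ))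
          (fun μ x => coordMat e (ContinuousLinearMap.mulLeftRight ℝ (Matrix n n ℂ) (fluct η A' μ x : Matrix n n ℂ) (fluct η A' μ x : Matrix n n ℂ)ᴴ))))
      (fun y y' => curvRowLetter κ J
          (@basisConst κ _ (Matrix n n ℂ) Matrix.frobeniusNormedAddCommGroup Matrix.frobeniusNormedSpace e * (2 * Real.sqrt (Fintype.card n)) *
            (Real.sqrt (Fintype.card n) * ((α₁ / scaleLen L η j) * Real.exp (η * (α₁ / scaleLen L η j)))))
          (@basisConst κ _ (Matrix n n ℂ) Matrix.frobeniusNormedAddCommGroup Matrix.frobeniusNormedSpace e * (2 * Real.sqrt (Fintype.card n)) *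
            (Real.sqrt (Fintype.card n) * ((α₁ / scaleLen L η j ^ 2) * Real.exp (η * (α₁ / scaleLen L η j))))) * (1 + Fintype.card (J ⊕ J)) *
        Real.exp (-(δV * g.dist y y'))) :=
  uN_hasMaj_curvSpecies_rate_of_cplx337_shape e τ V he blk hd0 hη hV (B9Eq335RegularityClasses.scaleLen_pos hL hη j) hα₁ hA (fun μ x => h.1 j μ x (hΩ x)) (fun μ ν x => h.2 j μ ν x (hΩ x)) δV

/-! ## §4 A6: the junction's hypothesis set is inhabited -/

omit [Nonempty n] [Fintype X] [Fintype J] in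
/-- **NON-VACUITY (A6)**: over ANY background the zero potential `A′ = 0` (`U′ = 1`) is Hermitian and lies in the class (3.37) for every `α₁ > 0`, `L ≥ 1`, `η > 0` (r06's `cplx337_zero`
BY NAME) — the junction `uN_hasMaj_curvSpecies_rate_of_cplx337` fires there (with the conclusion it has; nothing beyond inhabitation is claimed; the unperturbed point of Thm 3.4's domain).
[cite: Balaban1985BackgroundPropagators, (3.37) p.396 (the zero perturbation)] -/
theorem uN_cplx337_zero {η L : ℝ} (hη : 0 < η) (hL : 1 ≤ L) (lev : X → ℕ) {α₁ : ℝ} (hα₁ : 0 < α₁) :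
    (∀ μ x, ((0 : J → X → Matrix n n ℂ) μ x)ᴴ = (0 : J → X → Matrix n n ℂ) μ x) ∧ Cplx337 τ V η L lev α₁ (0 : J → X → Matrix n n ℂ) :=
  ⟨fun μ x => by simp, cplx337_zero τ V hL hη lev hα₁⟩

end Junction

end Summit.QuantumFields.YangMills.BalabanUVNodes.N15.CurvedSpecies

end
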